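import Literature.AnabelianGeometry.EtaleTheta.Discharge.Sec3Remark362OfCnst
import Literature.AnabelianGeometry.EtaleTheta.TemperedFrobenioidCnstTorsion
import HarnessLib

/-!
# [EtTh] Remark 3.6.2, conjunct 2, at the constructed data of monoid types `ℚ` and `ℝ` with
# `D^cnst = 𝓑(G)⁰` (proof-only)

S. Mochizuki, *The étale theta function …*, Publ. RIMS **45** (2009) [EtTh], §3, Remark 3.6.2, PDF p. 78;
Prop. 3.4 (ii) p. 74; Def. 3.6 (i) p. 76 [cite: MochizukiEtTh2009, Rmk 3.6.2 p.78].  abc-iut cell, layer L2, seat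
abc-iut-w5-d164 (gen 5); sequel of `Sec3Remark362OfCnst.lean` (p440523: `remark362_of_cosetCnst` — conjunct 2 of
`TemperedFrobenioid.Remark362` DERIVED at `D^cnst = CosetCat G` from Prop. 3.4 (ii) relative to `D^cnst` and
the constant-line inputs; `Λ = ℤ` constructed data there).  Here the same at the other two constructed Def. 3.6
(i) data, which SHARE `Φ₀^ℝ := Φ₀^rlf` and `ℝ·Φ₀^cnst` with `ofRlfZ` (abc-iut-w4-d008 `ofRlfQ_line` /
`ofRlfR_line`, `IsPerfFactorial.Rlf.isCancelMul`):
* `remark362_ofRlfQ_of_cosetCnst` — `Λ = ℚ` (`ofRlfQ dm hpf`): `P` ⟸ `h34 + h₀ + hT` (abc-iut-w4-d084 / abc-iut-L2-t3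
  `Prop34Cnst.ofRlfQ_of_torsion₀`, the named torsion predicate `Prop34Cnst₀Torsion` of census item A3);
  residual {`hS`, `h34`, `h₀`, `hT`, `hcyc`} and `…_of_prop34Const` {`hS`, `h34`, `h₀`, `hT`, `hC`};
* `remark362_ofRlfR_of_cosetCnst` — `Λ = ℝ` (`ofRlfR dm hpf`): `P` ⟸ `h₀ + hE` (clause 1 of Prop. 3.4 (ii) at
  `Λ = ℝ`, GAP G-w5d130-1; abc-iut-w4-d084 `Prop34Cnst.ofRlfR_of_eff`); residual {`hS`, `h₀`, `hE`, `hcyc`};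
  `remark362_ofRlfR_fin_of_cosetCnst` — print's finiteness setting (`hE` a theorem of `dm.Prop34`, abc-iut-w5-d130
  `Prop34Cnst.ofRlfR_of_finite_intPrimes`): residual {`hS`, `h34`, `h₀`, `hfin`, `hZQ`, `hcyc`}; plus the
  `…_of_prop34Const` forms.
No definitions; refereed pre-IUT material; nothing here bears on [IUTchIII] Cor. 3.12; typed ≠ proved.
-/

noncomputable section

namespace Literature.AnabelianGeometry.EtaleTheta

open CategoryTheory Opposite Literature.AlgebraicGeometry.Frobenioids Literature.AnabelianGeometry.SemiGraphs

namespace TemperedFrobenioid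

universe u₀ v₀ u₁ u v w

variable {D₀ : Type u₀} [Category.{v₀} D₀] (dm : DivisorMonoids.{u₀, v₀, w} D₀)
  (hpf : ∀ Y : D₀ᵒᵖ, IsPerfFactorial (dm.Φ₀.obj Y)) {V₀ : FrdICatStub.{u₀, v₀, w} D₀}
  {GK : Type u₁} [Group GK] [TopologicalSpace GK] [IsTopologicalGroup GK] [CompactSpace GK]
  {cnst : D₀ ⥤ CosetCat GK} {D : Type u} [Category.{v} D] {VD : FrdICatStub.{u, v, w} D}

/-! ### Monoid type `ℚ` -/

section OfRlfQ

variable (C : TemperedFrobenioid (RealifiedDivisorMonoids.ofRlfQ dm hpf) D VD)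

/-- **[EtTh] Remark 3.6.2 at the constructed `Λ = ℚ` data `ofRlfQ dm hpf` with `D^cnst = 𝓑(G)⁰`** (`G` compact),
conjunct 2 DERIVED: residual binders {`hS` (free [FrdI] Def. 4.5 (ii) stub), `h34 : dm.Prop34 _ V₀`,
`h₀ : dm.Prop34Cnst₀ cnst`, `hT : dm.Prop34Cnst₀Torsion cnst`, `hcyc`}. [cite: MochizukiEtTh2009, Rmk 3.6.2 p.78] -/
theorem remark362_ofRlfQ_of_cosetCnst (hS : VD.IsStrictlyRational C.bsFldMonoid)
    (h34 : dm.Prop34 treeMonoidVocab V₀) (h₀ : dm.Prop34Cnst₀ cnst) (hT : dm.Prop34Cnst₀Torsion cnst)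
    (hcyc : ∀ Y : D₀ᵒᵖ, ∃ d : dm.Φ₀.obj Y, ∀ b ∈ dm.F₀ Y, ∃ n : ℤ,
      dm.div₀ Y b = Algebra.GrothendieckGroup.of d ^ n) : C.Remark362 :=
  C.remark362_of_cosetCnst hS (RealifiedDivisorMonoids.Prop34Cnst.ofRlfQ_of_torsion₀ h34 h₀ hT)
    (RealifiedDivisorMonoids.ofRlfQ_line dm hpf hcyc)
    fun Y => IsPerfFactorial.Rlf.isCancelMul (hpf Y)

/-- **The same, knit onto `DivisorMonoids.Prop34Const`**: residual binders {`hS`, `h34`, `h₀`, `hT`,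
`hC : dm.Prop34Const`}. [cite: MochizukiEtTh2009, Rmk 3.6.2 p.78] -/
theorem remark362_ofRlfQ_of_prop34Const (hS : VD.IsStrictlyRational C.bsFldMonoid)
    (h34 : dm.Prop34 treeMonoidVocab V₀) (h₀ : dm.Prop34Cnst₀ cnst) (hT : dm.Prop34Cnst₀Torsion cnst)
    (hC : dm.Prop34Const) : C.Remark362 :=
  remark362_ofRlfQ_of_cosetCnst dm hpf C hS h34 h₀ hT hC.hcyc

end OfRlfQ

/-! ### Monoid type `ℝ` -/

section OfRlfR

variable (C : TemperedFrobenioid (RealifiedDivisorMonoids.ofRlfR dm hpf) D VD)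

/-- **[EtTh] Remark 3.6.2 at the constructed `Λ = ℝ` data `ofRlfR dm hpf` with `D^cnst = 𝓑(G)⁰`** (`G` compact),
conjunct 2 DERIVED: residual binders {`hS`, `h₀ : dm.Prop34Cnst₀ cnst`, `hE` (clause 1 of Prop. 3.4 (ii) at
`Λ = ℝ`, GAP G-w5d130-1), `hcyc`}. [cite: MochizukiEtTh2009, Rmk 3.6.2 p.78] -/
theorem remark362_ofRlfR_of_cosetCnst (hS : VD.IsStrictlyRational C.bsFldMonoid) (h₀ : dm.Prop34Cnst₀ cnst)
    (hE : ∀ (Y : D₀) (b : Algebra.GrothendieckGroup ((RealifiedDivisorMonoids.realData dm hpf).rlf.obj (op Y)))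
      (x : (hpf (op Y)).Rlf),
      b ∈ ((RealifiedDivisorMonoids.realData dm hpf).realSpan dm.biratGp).carrier Y →
        b = Algebra.GrothendieckGroup.of x →
        b ∈ ((RealifiedDivisorMonoids.realData dm hpf).realSpan dm.cnstGp).carrier Y)
    (hcyc : ∀ Y : D₀ᵒᵖ, ∃ d : dm.Φ₀.obj Y, ∀ b ∈ dm.F₀ Y, ∃ n : ℤ,
      dm.div₀ Y b = Algebra.GrothendieckGroup.of d ^ n) : C.Remark362 :=
  C.remark362_of_cosetCnst hS (RealifiedDivisorMonoids.Prop34Cnst.ofRlfR_of_eff h₀ hE)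
    (RealifiedDivisorMonoids.ofRlfR_line dm hpf hcyc)
    fun Y => IsPerfFactorial.Rlf.isCancelMul (hpf Y)

/-- **Print's finiteness setting** ("finitely many primes of each `Φ₀(Y)`, each `ℤ`- or `ℚ`-monoprime"): `hE` is a
THEOREM of `dm.Prop34` (abc-iut-w5-d130 `Prop34Cnst.ofRlfR_of_finite_intPrimes`), so the residual list is
{`hS`, `h34`, `h₀`, `hfin`, `hZQ`, `hcyc`}. [cite: MochizukiEtTh2009, Rmk 3.6.2 p.78] -/
theorem remark362_ofRlfR_fin_of_cosetCnst (hS : VD.IsStrictlyRational C.bsFldMonoid)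
    (h34 : dm.Prop34 treeMonoidVocab V₀) (h₀ : dm.Prop34Cnst₀ cnst)
    (hfin : ∀ Y : D₀, Finite (Primes (dm.Φ₀.obj (op Y))))
    (hZQ : ∀ (Y : D₀) (𝔭 : Primes (dm.Φ₀.obj (op Y))), IsZMonoprime ↥𝔭.submonoid ∨ IsQMonoprime ↥𝔭.submonoid)
    (hcyc : ∀ Y : D₀ᵒᵖ, ∃ d : dm.Φ₀.obj Y, ∀ b ∈ dm.F₀ Y, ∃ n : ℤ,
      dm.div₀ Y b = Algebra.GrothendieckGroup.of d ^ n) : C.Remark362 :=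
  C.remark362_of_cosetCnst hS (RealifiedDivisorMonoids.Prop34Cnst.ofRlfR_of_finite_intPrimes h34 h₀ hfin hZQ)
    (RealifiedDivisorMonoids.ofRlfR_line dm hpf hcyc)
    fun Y => IsPerfFactorial.Rlf.isCancelMul (hpf Y)

/-- **`Λ = ℝ`, knit onto `DivisorMonoids.Prop34Const`**: residual binders {`hS`, `h₀`, `hE`, `hC : dm.Prop34Const`}.
[cite: MochizukiEtTh2009, Rmk 3.6.2 p.78] -/
theorem remark362_ofRlfR_of_prop34Const (hS : VD.IsStrictlyRational C.bsFldMonoid) (h₀ : dm.Prop34Cnst₀ cnst)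
    (hE : ∀ (Y : D₀) (b : Algebra.GrothendieckGroup ((RealifiedDivisorMonoids.realData dm hpf).rlf.obj (op Y)))
      (x : (hpf (op Y)).Rlf),
      b ∈ ((RealifiedDivisorMonoids.realData dm hpf).realSpan dm.biratGp).carrier Y →
        b = Algebra.GrothendieckGroup.of x →
        b ∈ ((RealifiedDivisorMonoids.realData dm hpf).realSpan dm.cnstGp).carrier Y)
    (hC : dm.Prop34Const) : C.Remark362 :=
  remark362_ofRlfR_of_cosetCnst dm hpf C hS h₀ hE hC.hcyc

/-- **`Λ = ℝ`, print's finiteness setting, knit onto `DivisorMonoids.Prop34Const`**: residual binders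
{`hS`, `h34`, `h₀`, `hfin`, `hZQ`, `hC : dm.Prop34Const`}. [cite: MochizukiEtTh2009, Rmk 3.6.2 p.78] -/
theorem remark362_ofRlfR_fin_of_prop34Const (hS : VD.IsStrictlyRational C.bsFldMonoid)
    (h34 : dm.Prop34 treeMonoidVocab V₀) (h₀ : dm.Prop34Cnst₀ cnst)
    (hfin : ∀ Y : D₀, Finite (Primes (dm.Φ₀.obj (op Y))))
    (hZQ : ∀ (Y : D₀) (𝔭 : Primes (dm.Φ₀.obj (op Y))), IsZMonoprime ↥𝔭.submonoid ∨ IsQMonoprime ↥𝔭.submonoid)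
    (hC : dm.Prop34Const) : C.Remark362 :=
  remark362_ofRlfR_fin_of_cosetCnst dm hpf C hS h34 h₀ hfin hZQ hC.hcyc

end OfRlfR

end TemperedFrobenioid

end Literature.AnabelianGeometry.EtaleTheta

end
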